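import Summits.AtomisticToContinuum.HydrodynamicLimit.Theorems.TwoClocksEquilibriumFastWindowLDBirthT12Lorentz
import Summits.AtomisticToContinuum.HydrodynamicLimit.Theorems.TwoClocksEquilibriumFastWindowLDBirthT12LorentzB
import Summits.AtomisticToContinuum.HydrodynamicLimit.Theorems.EnskogAdjointDualityAdjointEnskogTestFamilyRHalfGaussianPrep
import HarnessLib

/-!
# The exact action of the gain and loss terms on the energy `‖·‖²`: `K₂‖·‖² - K₁‖·‖² = ν ‖v‖²`
# (helpers `t12_gainTerm_normSq_sub_lossTerm`, `t12_gainTerm_normSq_eq` of the line `birth`, crux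
# `TwoClocks.EquilibriumFastWindowLD`, stmt-AtomisticToContinuum-14440; infrastructure of the `ℓ = 0` bootstrap
# towards the registered analytic sub-goal `t12_logLinearPreimage_and_dipoleModulus`, plan §5)

Two elementary supplements to the `ℓ = 0` bootstrap of the corrector analysis (plan §5 of the line `birth`).

**1. The energy, exactly.** The zonal Euler–Volterra lemma (`t12_euler_zonal_quadraticPlusLinear`) produces the
resonant monopole `q‖v‖²` (`λ₀(2) = 1`, `…T12Indicial`), which the bootstrap must peel off EXACTLY, not up to the
(e-K₂) comparison error of `…T12GainRadialGrowthB`. With `gainTerm u v = ∫dM∫B u(v') + ∫dM∫B u(w')` (`…T12LorentzB`;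
`B = ((v-w)·ω)₊`, `M = stdGaussian`, `σ` the surface measure) and the loss term `K₁u(v) = ∫dM∫B u(w) = π∫‖v-w‖u(w)dM`
(`lossTerm_eq_pi_mul_integral`), energy conservation `‖v'‖² + ‖w'‖² = ‖v‖² + ‖w‖²` and the hat-box mass
`∫B dσ = π‖v - w‖` give, partner by partner, `∫B‖v'‖²dσ + ∫B‖w'‖²dσ = π‖v - w‖(‖v‖² + ‖w‖²)` (`gainPieces_normSq_eq`), so

* `gainTerm ‖·‖² v = ν(v)‖v‖² + π∫‖v - w‖‖w‖² dM(w)` (`gainTerm_normSq_eq`; registered `t12_gainTerm_normSq_eq` with the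
  size `0 ≤ π∫‖v - w‖‖w‖² dM ≤ 3π(‖v‖ + 3)` of the thermal correction: `‖v - w‖‖w‖² ≤ ‖v‖‖w‖² + (‖w‖² + ‖w‖⁴)/2`,
  `∫‖w‖² dM = 3`, `∫‖w‖⁴ dM = 15`);
* `K₁‖·‖²(v) = π∫‖v - w‖‖w‖² dM(w)` — the SAME integral (`lossTerm_normSq_eq`) — hence
  **`gainTerm ‖·‖² v - K₁‖·‖²(v) = ν(v)‖v‖²` EXACTLY** (registered `t12_gainTerm_normSq_sub_lossTerm`): `K‖·‖² = ν‖·‖²`,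
  `L‖·‖² = 0`, the energy invariant recovered inside the gain/loss bookkeeping;
* on the Lorentz side `lorentzGain ‖·‖² v = π‖v‖³` (`lorentzGain_normSq`, `λ₀(2) = 4/(2+2) = 1`) and
  `|gainTerm ‖·‖² v - π‖v‖³| ≤ (9/2)π(‖v‖ + 2)` (`abs_gainTerm_normSq_sub_lorentz`, from `πs ≤ ν ≤ π(s + 3/(2s))`,
  `t12_collisionFrequency_le_pi`): for this smooth weight the comparison error is `O(‖v‖)`, one power below the
  `O(W(‖v‖)) = O(‖v‖²)` of the rough class.

**2. The real-variable toolbox of the weight-class comparison** (`…T12GainRadialGrowthB`): the absolute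
Gaussian moments `M_4 = ∫(1 + |t|)⁴ dγ ≤ 22`, `M_6 = ∫(1 + |t|)⁶ dγ ≤ 176` (`integral_one_add_abs_pow_le`;
`2|t|ᵏ ≤ tᵏ⁻¹ + tᵏ⁺¹`, `∫t²dγ = 1`, `∫t⁴dγ = 3`, `∫t⁶dγ = 15`), and the membership of the log-linear weight
`(1 + t)(1 + log(1 + t))` (`n = 2`, `logLinearWeight_class`) and of the quadratic-log weight `(1 + t²)(1 + log(1 + t²))`
(`n = 4`, `quadLogWeight_class`) in the polynomial-increment class `W(s + t) ≤ W(s)(1 + t)ⁿ`.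

[folklore] (Cercignani–Illner–Pulvirenti 1994 §7.2: Grad's splitting and the collision invariants; Grad 1963 §4).
-/

noncomputable section

open MeasureTheory ProbabilityTheory Real Set Filter Metric
open scoped ENNReal BigOperators InnerProductSpace
namespace Summit.AtomisticToContinuum.HydrodynamicLimit.Theorems.ClampedCorrectorBirth

open Literature.Analysis.FluidPDE Literature.MathematicalPhysics.KineticTheory
open Literature.Analysis.UnboundedOperators Literature.Probability.Distributions

variable {v : EuclideanSpace ℝ (Fin 3)}

/-! ### Gaussian growth of the energy and the third absolute moment of `M` -/

/-- The energy has Gaussian growth: `‖x‖² ≤ 2 e^{‖x‖²/4}` (`e^y ≥ 1 + y + y²/2` at `y = ‖x‖²/4`). [folklore] -/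
theorem abs_norm_sq_le_two_mul_exp (x : EuclideanSpace ℝ (Fin 3)) : |‖x‖ ^ 2| ≤ 2 * Real.exp (‖x‖ ^ 2 / 4) := by
  rw [abs_of_nonneg (sq_nonneg _)]
  have h := Real.quadratic_le_exp_of_nonneg (by positivity : (0:ℝ) ≤ ‖x‖ ^ 2 / 4)
  nlinarith [sq_nonneg (‖x‖ ^ 2 / 4 - 1)]

/-- **`∫ ‖v - w‖ ‖w‖² dM(w) ≤ 3‖v‖ + 9`** with the integrability of the integrand
(`‖v - w‖ ‖w‖² ≤ ‖v‖ ‖w‖² + (‖w‖² + ‖w‖⁴)/2`, `∫ ‖w‖² dM = 3`, `∫ ‖w‖⁴ dM = 15`). [folklore] -/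
theorem integral_norm_sub_mul_norm_sq_le (v : EuclideanSpace ℝ (Fin 3)) :
    Integrable (fun w : EuclideanSpace ℝ (Fin 3) => ‖v - w‖ * ‖w‖ ^ 2) (stdGaussian (EuclideanSpace ℝ (Fin 3))) ∧
      0 ≤ ∫ w, ‖v - w‖ * ‖w‖ ^ 2 ∂stdGaussian (EuclideanSpace ℝ (Fin 3)) ∧
      ∫ w, ‖v - w‖ * ‖w‖ ^ 2 ∂stdGaussian (EuclideanSpace ℝ (Fin 3)) ≤ 3 * ‖v‖ + 9 := by
  set μ : Measure (EuclideanSpace ℝ (Fin 3)) := stdGaussian (EuclideanSpace ℝ (Fin 3)) with hμ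
  obtain ⟨h4m, h4⟩ := memLp_two_norm_sq_and_integral
  have hsq : Integrable (fun w : EuclideanSpace ℝ (Fin 3) => ‖w‖ ^ 2) μ :=
    (IsGaussian.memLp_id μ 2 (by simp)).integrable_norm_pow (by norm_num)
  have hqu : Integrable (fun w : EuclideanSpace ℝ (Fin 3) => (‖w‖ ^ 2) ^ 2) μ := h4m.integrable_sq
  have hI2 : ∫ w, ‖w‖ ^ 2 ∂μ = 3 := by
    rw [hμ, Literature.MathematicalPhysics.KineticTheory.integral_norm_sq_stdGaussian, Fintype.card_fin]
    norm_num
  have hdom : Integrable (fun w : EuclideanSpace ℝ (Fin 3) => ‖v‖ * ‖w‖ ^ 2 + (‖w‖ ^ 2 + (‖w‖ ^ 2) ^ 2) / 2) μ :=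
    (hsq.const_mul _).add ((hsq.add hqu).div_const _)
  have hpt : ∀ w : EuclideanSpace ℝ (Fin 3), ‖v - w‖ * ‖w‖ ^ 2 ≤ ‖v‖ * ‖w‖ ^ 2 + (‖w‖ ^ 2 + (‖w‖ ^ 2) ^ 2) / 2 :=
    fun w => by
      calc ‖v - w‖ * ‖w‖ ^ 2 ≤ (‖v‖ + ‖w‖) * ‖w‖ ^ 2 := mul_le_mul_of_nonneg_right (norm_sub_le v w) (sq_nonneg _)
        _ ≤ ‖v‖ * ‖w‖ ^ 2 + (‖w‖ ^ 2 + (‖w‖ ^ 2) ^ 2) / 2 := by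
            nlinarith [mul_nonneg (sq_nonneg (‖w‖ - 1)) (sq_nonneg ‖w‖), norm_nonneg w]
  have hint : Integrable (fun w : EuclideanSpace ℝ (Fin 3) => ‖v - w‖ * ‖w‖ ^ 2) μ :=
    hdom.mono' (Continuous.aestronglyMeasurable (by fun_prop)) (Eventually.of_forall fun w => by
      rw [Real.norm_of_nonneg (by positivity)]; exact hpt w)
  refine ⟨hint, integral_nonneg fun w => by positivity, ?_⟩
  calc ∫ w, ‖v - w‖ * ‖w‖ ^ 2 ∂μ ≤ ∫ w, (‖v‖ * ‖w‖ ^ 2 + (‖w‖ ^ 2 + (‖w‖ ^ 2) ^ 2) / 2) ∂μ := integral_mono hint hdom hpt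
    _ = 3 * ‖v‖ + 9 := by
        rw [integral_add (f := fun w : EuclideanSpace ℝ (Fin 3) => ‖v‖ * ‖w‖ ^ 2)
            (g := fun w : EuclideanSpace ℝ (Fin 3) => (‖w‖ ^ 2 + (‖w‖ ^ 2) ^ 2) / 2) (hsq.const_mul _)
            ((hsq.add hqu).div_const _), integral_const_mul, integral_div,
          integral_add (f := fun w : EuclideanSpace ℝ (Fin 3) => ‖w‖ ^ 2)
            (g := fun w : EuclideanSpace ℝ (Fin 3) => (‖w‖ ^ 2) ^ 2) hsq hqu, hI2, h4]
        ring

/-! ### Energy conservation, partner by partner -/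

/-- **Energy conservation under the flux measure, per partner**: for every `w`,
`∫_{S²} ((v-w)·ω)₊ ‖v'‖² dσ + ∫_{S²} ((v-w)·ω)₊ ‖w'‖² dσ = π ‖v - w‖ (‖v‖² + ‖w‖²)`
(`‖v'‖² + ‖w'‖² = ‖v‖² + ‖w‖²` and the hat-box mass `∫ ((v-w)·ω)₊ dσ = π‖v - w‖`), with the `M`-integrability of
both pieces. [folklore] -/
theorem gainPieces_normSq_eq (v : EuclideanSpace ℝ (Fin 3)) :
    (∀ w : EuclideanSpace ℝ (Fin 3),
      (∫ ω, hardSphereKernel (v, w) ω * ‖(collide ω (v, w)).1‖ ^ 2 ∂sphereMeasure) +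
          ∫ ω, hardSphereKernel (v, w) ω * ‖(collide ω (v, w)).2‖ ^ 2 ∂sphereMeasure =
        π * ‖v - w‖ * (‖v‖ ^ 2 + ‖w‖ ^ 2)) ∧
      Integrable (fun w => ∫ ω, hardSphereKernel (v, w) ω * ‖(collide ω (v, w)).1‖ ^ 2 ∂sphereMeasure)
        (stdGaussian (EuclideanSpace ℝ (Fin 3))) ∧
      Integrable (fun w => ∫ ω, hardSphereKernel (v, w) ω * ‖(collide ω (v, w)).2‖ ^ 2 ∂sphereMeasure)
        (stdGaussian (EuclideanSpace ℝ (Fin 3))) := by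
  obtain ⟨m1, m2⟩ := measurable_collide_param v
  have hψ : Measurable fun x : EuclideanSpace ℝ (Fin 3) => ‖x‖ ^ 2 := by fun_prop
  obtain ⟨i1, I1⟩ := integrable_kernel_mul_comp_of_gaussGrowth hψ abs_norm_sq_le_two_mul_exp v m1
    fun w ω => (norm_sq_collide_le ω v w).1
  obtain ⟨i2, I2⟩ := integrable_kernel_mul_comp_of_gaussGrowth hψ abs_norm_sq_le_two_mul_exp v m2
    fun w ω => (norm_sq_collide_le ω v w).2
  refine ⟨fun w => ?_, I1, I2⟩
  have i1w : Integrable (fun ω => hardSphereKernel (v, w) ω * ‖(collide ω (v, w)).1‖ ^ 2)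
      (sphereMeasure : Measure (sphere (0 : EuclideanSpace ℝ (Fin 3)) 1)) := i1 w
  have i2w : Integrable (fun ω => hardSphereKernel (v, w) ω * ‖(collide ω (v, w)).2‖ ^ 2)
      (sphereMeasure : Measure (sphere (0 : EuclideanSpace ℝ (Fin 3)) 1)) := i2 w
  rw [← integral_add i1w i2w]
  have hpt : ∀ ω : sphere (0 : EuclideanSpace ℝ (Fin 3)) 1,
      hardSphereKernel (v, w) ω * ‖(collide ω (v, w)).1‖ ^ 2 + hardSphereKernel (v, w) ω * ‖(collide ω (v, w)).2‖ ^ 2 =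
        hardSphereKernel (v, w) ω * (‖v‖ ^ 2 + ‖w‖ ^ 2) := fun ω => by
    rw [← mul_add, norm_sq_collide_fst_add_norm_sq_collide_snd ω (v, w)]
  rw [integral_congr_ae (Eventually.of_forall hpt), integral_mul_const, sphereIntegral_hardSphereKernel]

/-! ### The exact actions on the energy -/

/-- **The gain term on the energy, exactly**: `gainTerm ‖·‖² v = ν(v) ‖v‖² + π ∫ ‖v - w‖ ‖w‖² dM(w)`
(energy conservation per partner and `ν(v) = π ∫ ‖v - w‖ dM`). [folklore] -/
theorem gainTerm_normSq_eq (v : EuclideanSpace ℝ (Fin 3)) :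
    gainTerm (fun x => ‖x‖ ^ 2) v =
      collisionFrequency v * ‖v‖ ^ 2 + π * ∫ w, ‖v - w‖ * ‖w‖ ^ 2 ∂stdGaussian (EuclideanSpace ℝ (Fin 3)) := by
  obtain ⟨hw, I1, I2⟩ := gainPieces_normSq_eq v
  obtain ⟨hint, -, -⟩ := integral_norm_sub_mul_norm_sq_le v
  have hns : Integrable (fun w : EuclideanSpace ℝ (Fin 3) => ‖v - w‖) (stdGaussian (EuclideanSpace ℝ (Fin 3))) :=
    (memLp_two_norm_sub v).integrable (by norm_num)
  unfold gainTerm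
  rw [← integral_add I1 I2, integral_congr_ae (Eventually.of_forall hw), collisionFrequency_eq_pi_mul_integral_norm_sub]
  have hsplit : (fun w : EuclideanSpace ℝ (Fin 3) => π * ‖v - w‖ * (‖v‖ ^ 2 + ‖w‖ ^ 2)) =
      fun w => π * ‖v‖ ^ 2 * ‖v - w‖ + π * (‖v - w‖ * ‖w‖ ^ 2) := by
    funext w; ring
  rw [hsplit, integral_add (hns.const_mul _) (hint.const_mul _), integral_const_mul, integral_const_mul]
  ring

/-- **The loss term on the energy, exactly**: `K₁‖·‖²(v) = π ∫ ‖v - w‖ ‖w‖² dM(w)` (hat-box mass). [folklore] -/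
theorem lossTerm_normSq_eq (v : EuclideanSpace ℝ (Fin 3)) :
    ∫ w, ∫ ω, hardSphereKernel (v, w) ω * ‖w‖ ^ 2 ∂sphereMeasure ∂stdGaussian (EuclideanSpace ℝ (Fin 3)) =
      π * ∫ w, ‖v - w‖ * ‖w‖ ^ 2 ∂stdGaussian (EuclideanSpace ℝ (Fin 3)) :=
  lossTerm_eq_pi_mul_integral (fun x => ‖x‖ ^ 2) v

/-- **The energy invariant, recovered exactly**: `gainTerm ‖·‖² v - K₁‖·‖²(v) = ν(v) ‖v‖²`, i.e.
`K‖·‖² = ν ‖·‖²`, `L‖·‖² = 0` — the thermal correction `π ∫ ‖v - w‖ ‖w‖² dM` of the gain term IS the loss term.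
[folklore] -/
theorem gainTerm_normSq_sub_lossTerm (v : EuclideanSpace ℝ (Fin 3)) :
    gainTerm (fun x => ‖x‖ ^ 2) v -
        ∫ w, ∫ ω, hardSphereKernel (v, w) ω * ‖w‖ ^ 2 ∂sphereMeasure ∂stdGaussian (EuclideanSpace ℝ (Fin 3)) =
      collisionFrequency v * ‖v‖ ^ 2 := by
  rw [gainTerm_normSq_eq, lossTerm_normSq_eq]
  ring

/-- **The thermal correction is lower order**: `0 ≤ gainTerm ‖·‖² v - ν(v)‖v‖² ≤ 3π(‖v‖ + 3)`. [folklore] -/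
theorem gainTerm_normSq_sub_mem (v : EuclideanSpace ℝ (Fin 3)) :
    0 ≤ gainTerm (fun x => ‖x‖ ^ 2) v - collisionFrequency v * ‖v‖ ^ 2 ∧
      gainTerm (fun x => ‖x‖ ^ 2) v - collisionFrequency v * ‖v‖ ^ 2 ≤ 3 * π * (‖v‖ + 3) := by
  obtain ⟨-, h0, hle⟩ := integral_norm_sub_mul_norm_sq_le v
  rw [gainTerm_normSq_eq, add_sub_cancel_left]
  exact ⟨by positivity, by nlinarith [pi_pos]⟩

/-- **The Lorentz operator on the energy**: `lorentzGain ‖·‖² v = π‖v‖³` (`λ₀(2) = 1`: `t12_lorentzGain_rpow` at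
`α = 2`). [folklore] -/
theorem lorentzGain_normSq (v : EuclideanSpace ℝ (Fin 3)) : lorentzGain (fun x => ‖x‖ ^ 2) v = π * ‖v‖ ^ 3 := by
  have h := lorentzGain_rpow (α := 2) (by norm_num) v
  have h2 : (fun x : EuclideanSpace ℝ (Fin 3) => ‖x‖ ^ (2:ℝ)) = fun x => ‖x‖ ^ 2 := by
    funext x; exact Real.rpow_two _
  rw [h2, show (2:ℝ) + 1 = (3:ℕ) by norm_num, Real.rpow_natCast] at h
  rw [h]
  ring

/-- **The energy against its Lorentz limit**: `|gainTerm ‖·‖² v - π‖v‖³| ≤ (9/2)π(‖v‖ + 2)` — relative error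
`O(1/‖v‖²)`-sharp structure `ν‖v‖² - π‖v‖³ ∈ [0, (3/2)π‖v‖]` (`t12_collisionFrequency_le_pi`) plus the thermal
correction `≤ 3π(‖v‖ + 3)`. [folklore] -/
theorem abs_gainTerm_normSq_sub_lorentz (v : EuclideanSpace ℝ (Fin 3)) :
    |gainTerm (fun x => ‖x‖ ^ 2) v - π * ‖v‖ ^ 3| ≤ 9 / 2 * π * (‖v‖ + 2) := by
  obtain ⟨h0, hle⟩ := gainTerm_normSq_sub_mem v
  have hν1 := t12_collisionFrequency_le_pi v
  have hν2 := pi_mul_norm_le_collisionFrequency v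
  have hs := norm_nonneg v
  rw [abs_le]
  constructor <;> nlinarith [mul_le_mul_of_nonneg_left hν1 hs, mul_le_mul_of_nonneg_left hν2 hs, pi_pos,
    mul_nonneg pi_pos.le hs]

/-! ### The real-variable toolbox of the weight-class comparison: Gaussian moments of `(1 + |t|)ᵏ`
(`(1 + |t|)ᵏ ∈ L¹(γ)` is the tree's `EnskogAdjointDuality.k2r_ref_integrable_one_add_abs_pow`) -/

/-- **The two absolute Gaussian moments of the bootstrap**: `M_4 = ∫ (1 + |t|)⁴ dγ ≤ 22` and
`M_6 = ∫ (1 + |t|)⁶ dγ ≤ 176` (`(1 + u)⁴ ≤ 3 + 10u² + 3u⁴`, `(1 + u)⁶ ≤ 4 + 28u² + 28u⁴ + 4u⁶` for `u ≥ 0` — the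
differences are `2(1 - u)²(1 + u²)`, `(1 - u)²(3 + 10u² + 3u⁴)` — and `∫ t² dγ = 1`, `∫ t⁴ dγ = 3`, `∫ t⁶ dγ = 15`).
[folklore] -/
theorem integral_one_add_abs_pow_le :
    ∫ t, (1 + |t|) ^ 4 ∂gaussianReal 0 1 ≤ 22 ∧ ∫ t, (1 + |t|) ^ 6 ∂gaussianReal 0 1 ≤ 176 := by
  have i2 : Integrable (fun t : ℝ => t ^ 2) (gaussianReal 0 1) := integrable_pow_gaussianReal 0 1 2
  have i4 : Integrable (fun t : ℝ => t ^ 4) (gaussianReal 0 1) := integrable_pow_gaussianReal 0 1 4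
  have i6 : Integrable (fun t : ℝ => t ^ 6) (gaussianReal 0 1) := integrable_pow_gaussianReal 0 1 6
  have v2 : ∫ t : ℝ, t ^ 2 ∂gaussianReal 0 1 = 1 := by
    have h := integral_pow_even_gaussianReal_one 1
    norm_num [Nat.doubleFactorial] at h
    exact h
  have v4 : ∫ t : ℝ, t ^ 4 ∂gaussianReal 0 1 = 3 := by
    have h := integral_pow_even_gaussianReal_one 2
    norm_num [Nat.doubleFactorial] at h
    exact h
  have v6 : ∫ t : ℝ, t ^ 6 ∂gaussianReal 0 1 = 15 := by
    have h := integral_pow_even_gaussianReal_one 3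
    norm_num [Nat.doubleFactorial] at h
    exact h
  have hsq : ∀ t : ℝ, t ^ 2 = |t| ^ 2 := fun t => (sq_abs t).symm
  constructor
  · have ig : Integrable (fun t : ℝ => 3 + 10 * t ^ 2 + 3 * t ^ 4) (gaussianReal 0 1) :=
      ((integrable_const _).add (i2.const_mul _)).add (i4.const_mul _)
    calc ∫ t, (1 + |t|) ^ 4 ∂gaussianReal 0 1 ≤ ∫ t, (3 + 10 * t ^ 2 + 3 * t ^ 4) ∂gaussianReal 0 1 := by
          refine integral_mono (EnskogAdjointDuality.k2r_ref_integrable_one_add_abs_pow 4) ig fun t => ?_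
          have h4 : t ^ 4 = |t| ^ 4 := (Even.pow_abs (by norm_num) t).symm
          dsimp only
          rw [hsq, h4]
          nlinarith [mul_nonneg (sq_nonneg (1 - |t|)) (add_nonneg zero_le_one (sq_nonneg |t|))]
      _ = 22 := by
          rw [integral_add (f := fun t : ℝ => 3 + 10 * t ^ 2) (g := fun t : ℝ => 3 * t ^ 4)
              ((integrable_const _).add (i2.const_mul _)) (i4.const_mul _),
            integral_add (f := fun _ : ℝ => (3:ℝ)) (g := fun t : ℝ => 10 * t ^ 2) (integrable_const _) (i2.const_mul _),
            integral_const_mul, integral_const_mul, integral_const, v2, v4, probReal_univ]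
          norm_num
  · have ig : Integrable (fun t : ℝ => 4 + 28 * t ^ 2 + 28 * t ^ 4 + 4 * t ^ 6) (gaussianReal 0 1) :=
      (((integrable_const _).add (i2.const_mul _)).add (i4.const_mul _)).add (i6.const_mul _)
    calc ∫ t, (1 + |t|) ^ 6 ∂gaussianReal 0 1 ≤ ∫ t, (4 + 28 * t ^ 2 + 28 * t ^ 4 + 4 * t ^ 6) ∂gaussianReal 0 1 := by
          refine integral_mono (EnskogAdjointDuality.k2r_ref_integrable_one_add_abs_pow 6) ig fun t => ?_
          have h4 : t ^ 4 = |t| ^ 4 := (Even.pow_abs (by norm_num) t).symm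
          have h6 : t ^ 6 = |t| ^ 6 := (Even.pow_abs (by norm_num) t).symm
          dsimp only
          rw [hsq, h4, h6]
          nlinarith [mul_nonneg (sq_nonneg (1 - |t|))
            (by positivity : (0:ℝ) ≤ 3 + 10 * |t| ^ 2 + 3 * |t| ^ 4)]
      _ = 176 := by
          rw [integral_add (f := fun t : ℝ => 4 + 28 * t ^ 2 + 28 * t ^ 4) (g := fun t : ℝ => 4 * t ^ 6)
              (((integrable_const _).add (i2.const_mul _)).add (i4.const_mul _)) (i6.const_mul _),
            integral_add (f := fun t : ℝ => 4 + 28 * t ^ 2) (g := fun t : ℝ => 28 * t ^ 4)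
              ((integrable_const _).add (i2.const_mul _)) (i4.const_mul _),
            integral_add (f := fun _ : ℝ => (4:ℝ)) (g := fun t : ℝ => 28 * t ^ 2) (integrable_const _) (i2.const_mul _),
            integral_const_mul, integral_const_mul, integral_const_mul, integral_const, v2, v4, v6, probReal_univ]
          norm_num

/-! ### The two weight classes of the `ℓ = 0` bootstrap -/

/-- **The log-linear weight** `W(t) = (1 + t)(1 + log(1 + t))` is in the class with `n = 2`: nondecreasing and
`≥ 1` on `[0, ∞)`, and `W(s + t) ≤ W(s)(1 + t)²` (`1 + s + t ≤ (1 + s)(1 + t)`,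
`log(1 + s + t) ≤ log(1 + s) + log(1 + t) ≤ log(1 + s) + t`). [folklore] -/
theorem logLinearWeight_class :
    (∀ a b : ℝ, 0 ≤ a → a ≤ b → (1 + a) * (1 + Real.log (1 + a)) ≤ (1 + b) * (1 + Real.log (1 + b))) ∧
      (∀ a : ℝ, 0 ≤ a → 1 ≤ (1 + a) * (1 + Real.log (1 + a))) ∧
      ∀ s t : ℝ, 0 ≤ s → 0 ≤ t →
        (1 + (s + t)) * (1 + Real.log (1 + (s + t))) ≤ (1 + s) * (1 + Real.log (1 + s)) * (1 + t) ^ 2 := by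
  have hlog0 : ∀ a : ℝ, 0 ≤ a → 0 ≤ Real.log (1 + a) := fun a ha => Real.log_nonneg (by linarith)
  refine ⟨fun a b ha hab => ?_, fun a ha => ?_, fun s t hs ht => ?_⟩
  · exact mul_le_mul (by linarith) (by linarith [Real.log_le_log (by linarith) (by linarith : 1 + a ≤ 1 + b)])
      (by linarith [hlog0 a ha]) (by linarith)
  · nlinarith [hlog0 a ha]
  · have h1 : 1 + (s + t) ≤ (1 + s) * (1 + t) := by nlinarith
    have h2 : Real.log (1 + (s + t)) ≤ Real.log (1 + s) + t := by
      calc Real.log (1 + (s + t)) ≤ Real.log ((1 + s) * (1 + t)) := Real.log_le_log (by linarith) h1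
        _ = Real.log (1 + s) + Real.log (1 + t) := Real.log_mul (by linarith) (by linarith)
        _ ≤ Real.log (1 + s) + t := by linarith [Real.log_le_sub_one_of_pos (by linarith : (0:ℝ) < 1 + t)]
    have h3 : 1 + Real.log (1 + (s + t)) ≤ (1 + Real.log (1 + s)) * (1 + t) := by nlinarith [hlog0 s hs]
    calc (1 + (s + t)) * (1 + Real.log (1 + (s + t))) ≤ ((1 + s) * (1 + t)) * ((1 + Real.log (1 + s)) * (1 + t)) :=
          mul_le_mul h1 h3 (by linarith [hlog0 (s + t) (by linarith)]) (by positivity)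
      _ = (1 + s) * (1 + Real.log (1 + s)) * (1 + t) ^ 2 := by ring

/-- **The quadratic-log weight** `W(t) = (1 + t²)(1 + log(1 + t²))` is in the class with `n = 4`: nondecreasing and
`≥ 1` on `[0, ∞)`, and `W(s + t) ≤ W(s)(1 + t)⁴` (`1 + (s + t)² ≤ (1 + s²)(1 + t)²`,
`log(1 + (s + t)²) ≤ log(1 + s²) + 2 log(1 + t) ≤ log(1 + s²) + 2t`, `1 + 2t ≤ (1 + t)²`). [folklore] -/
theorem quadLogWeight_class :
    (∀ a b : ℝ, 0 ≤ a → a ≤ b → (1 + a ^ 2) * (1 + Real.log (1 + a ^ 2)) ≤ (1 + b ^ 2) * (1 + Real.log (1 + b ^ 2))) ∧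
      (∀ a : ℝ, 0 ≤ a → 1 ≤ (1 + a ^ 2) * (1 + Real.log (1 + a ^ 2))) ∧
      ∀ s t : ℝ, 0 ≤ s → 0 ≤ t →
        (1 + (s + t) ^ 2) * (1 + Real.log (1 + (s + t) ^ 2)) ≤ (1 + s ^ 2) * (1 + Real.log (1 + s ^ 2)) * (1 + t) ^ 4 := by
  have hlog0 : ∀ a : ℝ, 0 ≤ Real.log (1 + a ^ 2) := fun a => Real.log_nonneg (by nlinarith)
  refine ⟨fun a b ha hab => ?_, fun a _ => ?_, fun s t hs ht => ?_⟩
  · have hab2 : a ^ 2 ≤ b ^ 2 := pow_le_pow_left₀ ha hab 2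
    exact mul_le_mul (by linarith) (by linarith [Real.log_le_log (by nlinarith) (by linarith : 1 + a ^ 2 ≤ 1 + b ^ 2)])
      (by linarith [hlog0 a]) (by nlinarith)
  · nlinarith [hlog0 a, sq_nonneg a]
  · have h1 : 1 + (s + t) ^ 2 ≤ (1 + s ^ 2) * (1 + t) ^ 2 := by
      nlinarith [mul_nonneg ht (sq_nonneg s), mul_nonneg (sq_nonneg s) (sq_nonneg t), mul_nonneg hs ht]
    have h2 : Real.log (1 + (s + t) ^ 2) ≤ Real.log (1 + s ^ 2) + 2 * t := by
      calc Real.log (1 + (s + t) ^ 2) ≤ Real.log ((1 + s ^ 2) * (1 + t) ^ 2) := Real.log_le_log (by nlinarith) h1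
        _ = Real.log (1 + s ^ 2) + 2 * Real.log (1 + t) := by
            rw [Real.log_mul (by nlinarith) (by positivity), Real.log_pow]; push_cast; ring
        _ ≤ Real.log (1 + s ^ 2) + 2 * t := by linarith [Real.log_le_sub_one_of_pos (by linarith : (0:ℝ) < 1 + t)]
    have h3 : 1 + Real.log (1 + (s + t) ^ 2) ≤ (1 + Real.log (1 + s ^ 2)) * (1 + t) ^ 2 := by
      nlinarith [hlog0 s, mul_nonneg (hlog0 s) (sq_nonneg t), mul_nonneg (hlog0 s) ht]
    calc (1 + (s + t) ^ 2) * (1 + Real.log (1 + (s + t) ^ 2))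
        ≤ ((1 + s ^ 2) * (1 + t) ^ 2) * ((1 + Real.log (1 + s ^ 2)) * (1 + t) ^ 2) :=
          mul_le_mul h1 h3 (by linarith [hlog0 (s + t)]) (by positivity)
      _ = (1 + s ^ 2) * (1 + Real.log (1 + s ^ 2)) * (1 + t) ^ 4 := by ring

/-! ### Registered helpers -/

/-- **Registered helper `t12_gainTerm_normSq_sub_lossTerm` — the energy invariant of the linearised hard-sphere
operator, in the gain/loss bookkeeping of the `ℓ = 0` bootstrap.** For every `v ∈ ℝ³` (`M = stdGaussian`, `σ` the
surface measure of `S²`, `(v', w') = collide ω (v, w)`, `ν = collisionFrequency`):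
`∫ dM(w) ∫_{S²} ((v-w)·ω)₊ ‖v'‖² dσ + ∫ dM(w) ∫_{S²} ((v-w)·ω)₊ ‖w'‖² dσ - ∫ dM(w) ∫_{S²} ((v-w)·ω)₊ ‖w‖² dσ = ν(v) ‖v‖²`,
i.e. `K₂‖·‖² - K₁‖·‖² = ν ‖·‖²` EXACTLY (`K‖·‖² = ν‖·‖²`, `L‖·‖² = 0`): by energy conservation
`‖v'‖² + ‖w'‖² = ‖v‖² + ‖w‖²` and the hat-box mass `∫ ((v-w)·ω)₊ dσ = π‖v - w‖`, per partner
`∫ B ‖v'‖² + ∫ B ‖w'‖² = π‖v - w‖(‖v‖² + ‖w‖²)`, whence `gainTerm ‖·‖² v = ν(v)‖v‖² + π∫‖v - w‖‖w‖² dM`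
(`gainTerm_normSq_eq`) while `K₁‖·‖²(v) = π∫‖v - w‖‖w‖² dM` is the SAME integral (`lossTerm_normSq_eq`). This is
what lets the bootstrap peel off the resonant monopole `q‖v‖²` (`λ₀(2) = 1`) exactly rather than up to a comparison
error. [folklore] -/
theorem t12_gainTerm_normSq_sub_lossTerm : ∀ v : EuclideanSpace ℝ (Fin 3), (∫ w, ∫ ω, Literature.MathematicalPhysics.KineticTheory.hardSphereKernel (v, w) ω * ‖(Literature.MathematicalPhysics.KineticTheory.collide ω (v, w)).1‖ ^ 2 ∂Literature.MathematicalPhysics.KineticTheory.sphereMeasure ∂ProbabilityTheory.stdGaussian (EuclideanSpace ℝ (Fin 3))) + (∫ w, ∫ ω, Literature.MathematicalPhysics.KineticTheory.hardSphereKernel (v, w) ω * ‖(Literature.MathematicalPhysics.KineticTheory.collide ω (v, w)).2‖ ^ 2 ∂Literature.MathematicalPhysics.KineticTheory.sphereMeasure ∂ProbabilityTheory.stdGaussian (EuclideanSpace ℝ (Fin 3))) - (∫ w, ∫ ω, Literature.MathematicalPhysics.KineticTheory.hardSphereKernel (v, w) ω * ‖w‖ ^ 2 ∂Literature.MathematicalPhysics.KineticTheory.sphereMeasure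 ∂ProbabilityTheory.stdGaussian (EuclideanSpace ℝ (Fin 3))) = Literature.Analysis.UnboundedOperators.collisionFrequency v * ‖v‖ ^ 2 :=
  fun v => gainTerm_normSq_sub_lossTerm v

/-- **Registered helper `t12_gainTerm_normSq_eq` — the exact gain term on the energy and the size of its thermal
correction.** For every `v ∈ ℝ³` (`M = stdGaussian`, `σ` the surface measure of `S²`, `(v', w') = collide ω (v, w)`,
`ν = collisionFrequency`):
`∫ dM(w) ∫_{S²} ((v-w)·ω)₊ ‖v'‖² dσ + ∫ dM(w) ∫_{S²} ((v-w)·ω)₊ ‖w'‖² dσ = ν(v)‖v‖² + π ∫ ‖v - w‖ ‖w‖² dM(w)` and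
`0 ≤ π ∫ ‖v - w‖ ‖w‖² dM(w) ≤ 3π(‖v‖ + 3)` (`‖v - w‖‖w‖² ≤ ‖v‖‖w‖² + (‖w‖² + ‖w‖⁴)/2`, `∫‖w‖² dM = 3`, `∫‖w‖⁴ dM = 15`):
the action of `K₂` on the resonant monopole `‖v‖²` is `ν‖v‖²` up to an explicit `O(1 + ‖v‖)`, against the Lorentz
value `lorentzGain ‖·‖² v = π‖v‖³` (`lorentzGain_normSq`; `|gainTerm ‖·‖² v - π‖v‖³| ≤ (9/2)π(‖v‖ + 2)`,
`abs_gainTerm_normSq_sub_lorentz`). [folklore] -/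
theorem t12_gainTerm_normSq_eq : ∀ v : EuclideanSpace ℝ (Fin 3), (∫ w, ∫ ω, Literature.MathematicalPhysics.KineticTheory.hardSphereKernel (v, w) ω * ‖(Literature.MathematicalPhysics.KineticTheory.collide ω (v, w)).1‖ ^ 2 ∂Literature.MathematicalPhysics.KineticTheory.sphereMeasure ∂ProbabilityTheory.stdGaussian (EuclideanSpace ℝ (Fin 3))) + (∫ w, ∫ ω, Literature.MathematicalPhysics.KineticTheory.hardSphereKernel (v, w) ω * ‖(Literature.MathematicalPhysics.KineticTheory.collide ω (v, w)).2‖ ^ 2 ∂Literature.MathematicalPhysics.KineticTheory.sphereMeasure ∂ProbabilityTheory.stdGaussian (EuclideanSpace ℝ (Fin 3))) = Literature.Analysis.UnboundedOperators.collisionFrequency v * ‖v‖ ^ 2 + Real.pi * ∫ w, ‖v - w‖ * ‖w‖ ^ 2 ∂ProbabilityTheory.stdGaussian (EuclideanSpace ℝ (Fin 3)) ∧ 0 ≤ Real.pi * ∫ w, ‖v - w‖ * ‖w‖ ^ 2 ∂ProbabilityTheory.stdGaussian (EuclideanSpace ℝ (Fin 3)) ∧ Real.pi * ∫ w, ‖v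 - w‖ * ‖w‖ ^ 2 ∂ProbabilityTheory.stdGaussian (EuclideanSpace ℝ (Fin 3)) ≤ 3 * Real.pi * (‖v‖ + 3) := by
  intro v
  obtain ⟨-, h0, hle⟩ := integral_norm_sub_mul_norm_sq_le v
  exact ⟨gainTerm_normSq_eq v, by positivity, by nlinarith [pi_pos]⟩

end Summit.AtomisticToContinuum.HydrodynamicLimit.Theorems.ClampedCorrectorBirth

end
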